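import Summits.FinalStateConjecture.FinalStateConjecture.Theses.TangentConeAtIPlus

/-!
# Birth skeleton — crux `TangentConeAtIPlus.KerrCaptureOnRays` (stmt-FinalStateConjecture-17669)

Skeleton registrar `planner-skel-stmt-FinalStateConjecture-17669-0`, 2026-08-17 (route
`route-FinalStateConjecture-TangentConeAtIPlus`, rev 4; re-audit bin REPAIRABLE: the crux had no registered
skeleton).  The crux is FIXED and concluded BY NAME by `KerrCaptureOnRays_of`:
`Summit.FinalStateConjecture.FinalStateConjecture.Theses.TangentConeAtIPlus.KerrCaptureOnRays` — for EVERY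
admissible datum, MGHD and cone data at `i⁺` (the route's `let Cone`), there are HOLE DATA (the route's
`let Holes`): sub-extremal `(Mᵢ,aᵢ)`, ONE late time `τ₀ ≥ T` and charts `Ψᵢ` of the boosted Kerr exteriors —
open embeddings of the near regions `Wᵢ(τ₀)` into `J⁺(ιΣ)`, `C²`-converging to boosted Kerr on fixed and on
growing truncated slabs, glued to the flat chart on the annuli — whose truncated world-tubes are pairwise
disjoint late.

## The line in one paragraph (the route's own two-layer plan for K2: ONE RAY, then SEPARATION)

The crux bundles a per-ray ANALYTIC statement (localised sub-extremal Kerr stability along one ray, used as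
ε-regularity scale by scale — route header "KerrCaptureOnRays ⇐ LocalisedKerrStability → IterateOverScales")
with a GLOBAL clause (one common late time, pairwise separation of the truncated world-tubes).  The cut:

* `stub_captureAlongEachRay` (XL, the load-bearing stub): cone data ⇒ for EACH ray `i` separately, a
  captured chart — sub-extremal `(M,a)`, a time `τ` and `Ψ : boosted Kerr exterior → M` with exactly the
  per-ray clauses of the route's `Holes` (`RayCapture` below: smooth; open embedding of the near region
  `W(τ)`; image in `J⁺(ιΣ)`; `C²` deviation → 0 on every fixed-radius slab and on the growing slabs
  `r ≤ σᵢ(τ')+5`; agreement with `Φ ∘ (x ↦ x + dᵢ(tᵢ x))` on the late annulus).  No common time, no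
  separation: this is "Kerr stability LOCALISED to one ray" and nothing else.
* `stub_capturedRaysSeparate` (L): cone data + ANY family of captured charts (one per ray, each with its
  own time) ⇒ for every radius `r` the truncated world-tubes `Ψᵢ({t*ᵢ > τ₁, rᵢ ≤ r})` are pairwise disjoint
  for some `τ₁` — the causal/flat bookkeeping that turns the cone's DISJOINT-TUBES clause
  (`tubeᵢ(5) ∩ tubeⱼ(5) = ∅`) plus the annulus agreements into separation of the near zones in `M`.
* `KerrCaptureOnRays_of : S1 → S2 → KerrCaptureOnRays` is PROVED below (no `sorry` of its own): choice over
  the finitely many rays, a common late time `τ₀ := max T (sup τᵢ)`, MONOTONICITY of the per-ray clauses in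
  the cut-off time (the near regions `W(τ₀) ⊆ W(τᵢ)` are open — continuity of the Poincaré map, of the
  spatial norm and of `σᵢ` (a clause of the cone data) — so the open embedding and the `J⁺` clause restrict,
  and the annulus clause weakens), then S2.

Probes (BC3, folder `bc/`): neither stub implies the crux or `FinalStateConjecture` by
`first | exact? | simpa | aesop` (S1 lacks separation and a common time; S2 has the captured family as
antecedent).  Disproof used: none (no `Cruxes/KerrCaptureOnRays/Disproof.lean` exists at registration).
-/

noncomputable section

open scoped BigOperators Topology Manifold Classical MeasureTheory ProbabilityTheory Matrix InnerProductSpace ComplexConjugate ContinuousMap ContDiff ENNReal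
open Filter Set Function TopologicalSpace MeasureTheory
open Literature.Geometry.Lorentzian

namespace Summit.FinalStateConjecture.FinalStateConjecture.Cruxes.KerrCaptureOnRays.Birth

/-! ## The route's predicates, by name (verbatim the `let Cone` / `let Holes` of the route items) -/

/-- **Cone data at `i⁺`** — VERBATIM the `let Cone := …` shared by the items of route `TangentConeAtIPlus`
(orthochronous straight world-lines `(Λᵢ,cᵢ)`, continuous sublinear `σᵢ, dᵢ`, disjoint drifted tubes after
time `T`, one future-oriented flat late chart `Φ : U → M` into `J⁺(S)`, scale-invariant interior flatness,
wave-zone flatness, and the per-ray BASIN clause).  `kerrCaptureOnRays_iff` below is `Iff.rfl`. -/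
def ConeData (𝓢 : Spacetime.{0} 4) (S : Set 𝓢.carrier) (N : ℕ) (mo : Fin N → lorentzGroup × E4)
    (σ : Fin N → ℝ → ℝ) (dr : Fin N → ℝ → E4) (T : ℝ) (U : Opens E4) (Φ : U → 𝓢.carrier) : Prop :=
  let t := fun i (x : E4) => poincareInv (mo i).1 (mo i).2 x 0; let d := fun i (x : E4) => E4.spatialNorm (poincareInv (mo i).1 (mo i).2 x); let tube := fun i (w : ℝ) => (fun x ↦ x + dr i (t i x)) '' {x : E4 | d i x ≤ σ i (t i x) + w} ∩ {y | T < y 0}; let F := Minkowski.backgroundOn U; (∀ i, Summit.FinalStateConjecture.IsOrthochronous (mo i).1 ∧ Continuous (σ i) ∧ Continuous (dr i) ∧ Tendsto (fun s : ℝ ↦ (|σ i s| + ‖dr i s‖) / s) atTop (𝓝 0) ∧ Tendsto (σ i) atTop atTop) ∧ (∀ i j, i ≠ j → Disjoint (tube i 5) (tube j 5)) ∧ {y : E4 | T < y 0} \ (⋃ i, tube i 0) ⊆ (U : Set E4) ∧ 𝓢.IsLateChart F (𝓢.metric.causalFuture 𝓢.timeOrientation S) T Φ ∧ (∀ x : U,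 𝓢.timeOrientation.IsFutureDirected (mfderiv 𝓘(ℝ, E4) (𝓡 4) Φ x (EuclideanSpace.single 0 1))) ∧ (∀ δ : ℝ, 0 < δ → Tendsto (fun τ : ℝ ↦ weightedCkSeminorm {x : E4 | x 0 = τ ∧ E4.spatialNorm x ≤ (1 - δ) * τ ∧ ∀ i, δ * τ ≤ d i x} 2 0 (𝓢.deviationExtend F Φ)) atTop (𝓝 0)) ∧ Tendsto (fun τ : ℝ ↦ 𝓢.deviationCk F Φ 2 τ) atTop (𝓝 0) ∧ (∀ i, ∃ M a : ℝ, Kerr.IsSubextremal M a ∧ ∀ ε : ENNReal, 0 < ε → ∀ τ₁ : ℝ, ∃ τ : ℝ, τ₁ ≤ τ ∧ (let B := boostedKerrBackground (mo i).1 (mo i).2 M a; ∃ Ψ : B.domain → 𝓢.carrier, ContMDiff 𝓘(ℝ, E4) (𝓡 4) ∞ Ψ ∧ Topology.IsOpenEmbedding ({x : B.domain | |t i x.1 - τ| < 1 ∧ d i x.1 < σ i (t i x.1) + |a| + 6}.restrict Ψ) ∧ (∀ x : B.domain, |t i x.1 - τ| < 1 → σ i (t i x.1) + 1 ≤ d i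 x.1 → d i x.1 < σ i (t i x.1) + 4 → ∃ hx : x.1 + dr i (t i x.1) ∈ (U : Set E4), Ψ x = Φ ⟨_, hx⟩) ∧ 𝓢.truncDeviationCk B Ψ 2 (σ i τ + 5) τ ≤ ε))

/-- **Hole data** — VERBATIM the `let Holes := …` of the crux: sub-extremal parameters, `T ≤ τ₀`, per-ray
smooth charts that are open embeddings of the near regions `Wᵢ(τ₀)` into `J⁺(S)`, `C²` convergence on
fixed and on growing truncated slabs, annulus agreement with the flat chart, pairwise separation of the
truncated world-tubes. -/
def HoleData (𝓢 : Spacetime.{0} 4) (S : Set 𝓢.carrier) (N : ℕ) (mo : Fin N → lorentzGroup × E4)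
    (σ : Fin N → ℝ → ℝ) (dr : Fin N → ℝ → E4) (T : ℝ) (U : Opens E4) (Φ : U → 𝓢.carrier)
    (M a : Fin N → ℝ) (τ₀ : ℝ)
    (Ψ : ∀ i, (boostedKerrBackground (mo i).1 (mo i).2 (M i) (a i)).domain → 𝓢.carrier) : Prop :=
  let B := fun i => boostedKerrBackground (mo i).1 (mo i).2 (M i) (a i); let t := fun i (x : E4) => poincareInv (mo i).1 (mo i).2 x 0; let d := fun i (x : E4) => E4.spatialNorm (poincareInv (mo i).1 (mo i).2 x); let W := fun i => {x : (B i).domain | τ₀ < t i x.1 ∧ d i x.1 < σ i (t i x.1) + |a i| + 6}; (∀ i, Kerr.IsSubextremal (M i) (a i)) ∧ T ≤ τ₀ ∧ (∀ i, ContMDiff 𝓘(ℝ, E4) (𝓡 4) ∞ (Ψ i) ∧ Topology.IsOpenEmbedding ((W i).restrict (Ψ i)) ∧ Ψ i '' W i ⊆ 𝓢.metric.causalFuture 𝓢.timeOrientation S) ∧ (∀ i (r : ℝ), Tendsto (fun τ : ℝ ↦ 𝓢.truncDeviationCk (B i) (Ψ i) 2 r τ) atTop (𝓝 0)) ∧ (∀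 i, Tendsto (fun τ : ℝ ↦ 𝓢.truncDeviationCk (B i) (Ψ i) 2 (σ i τ + 5) τ) atTop (𝓝 0)) ∧ (∀ i (x : (B i).domain), τ₀ < t i x.1 → σ i (t i x.1) + 1 ≤ d i x.1 → d i x.1 < σ i (t i x.1) + 4 → T + 1 < (x.1 + dr i (t i x.1)) 0 → ∃ hx : x.1 + dr i (t i x.1) ∈ (U : Set E4), Ψ i x = Φ ⟨_, hx⟩) ∧ (∀ r : ℝ, ∃ τ₁ : ℝ, Pairwise (Function.onFun Disjoint fun i ↦ Ψ i '' (B i).truncLateRegion τ₁ r))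

/-- The crux, unfolded through the two named predicates: a DEFINITIONAL unfolding (`Iff.rfl`). -/
theorem kerrCaptureOnRays_iff :
    Theses.TangentConeAtIPlus.KerrCaptureOnRays ↔
      ∀ (X : Type) [TopologicalSpace X] [ChartedSpace E3 X] [IsManifold (𝓡 3) ∞ X] [T2Space X]
        [SecondCountableTopology X] [ConnectedSpace X] (D : InitialDataSet (𝓡 3) X),
        D ∈ admissibleVacuumData X → ∀ 𝒟 : VacuumCauchyDevelopment D, 𝒟.IsMaximal →
        ∀ (N : ℕ) (mo : Fin N → lorentzGroup × E4) (σ : Fin N → ℝ → ℝ) (dr : Fin N → ℝ → E4) (T : ℝ)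
          (U : Opens E4) (Φ : U → 𝒟.carrier),
          ConeData 𝒟.toSpacetime (range 𝒟.embed) N mo σ dr T U Φ →
          ∃ (M a : Fin N → ℝ) (τ₀ : ℝ)
            (Ψ : ∀ i, (boostedKerrBackground (mo i).1 (mo i).2 (M i) (a i)).domain → 𝒟.carrier),
            HoleData 𝒟.toSpacetime (range 𝒟.embed) N mo σ dr T U Φ M a τ₀ Ψ :=
  Iff.rfl

/-! ## The per-ray predicate of the line -/

/-- The **near region** `Wᵢ(τ) = {tᵢ > τ, dᵢ < σᵢ(tᵢ) + |a| + 6}` of ray `i` in the boosted Kerr exterior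
`(Λᵢ, cᵢ, M, a)` (rest time `tᵢ` and rest-frame Euclidean distance `dᵢ` of the straight world-line; verbatim the
`let W` of the crux with cut-off time `τ`). -/
def nearRegion {N : ℕ} (mo : Fin N → lorentzGroup × E4) (σ : Fin N → ℝ → ℝ) (i : Fin N) (M a τ : ℝ) :
    Set (boostedKerrBackground (mo i).1 (mo i).2 M a).domain :=
  {x | τ < poincareInv (mo i).1 (mo i).2 x.1 0 ∧
    E4.spatialNorm (poincareInv (mo i).1 (mo i).2 x.1) <
      σ i (poincareInv (mo i).1 (mo i).2 x.1 0) + |a| + 6}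

/-- **Captured chart along ONE ray** (`RayCapture … i M a τ Ψ`): exactly the clauses of the crux's `Holes`
that concern the single ray `i`, with its own cut-off time `τ` — `(M,a)` sub-extremal; `Ψ` smooth on the
boosted Kerr exterior; `Ψ` an open embedding of the near region `Wᵢ(τ)` with `Ψ(Wᵢ(τ)) ⊆ J⁺(S)`; the `C²`
deviation of `Ψ^* g` from boosted Kerr `→ 0` on every fixed-radius truncated slab AND on the growing slabs
`{t*ᵢ = τ', rᵢ ≤ σᵢ(τ') + 5}`; and on the annulus `σᵢ(tᵢ)+1 ≤ dᵢ < σᵢ(tᵢ)+4` beyond rest time `τ`, wherever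
the drifted point has flat time `> T+1`, it lies in `U` and `Ψ x = Φ(x + dᵢ(tᵢ x))`.  NO common time with
other rays and NO separation clause. -/
def RayCapture (𝓢 : Spacetime.{0} 4) (S : Set 𝓢.carrier) (N : ℕ) (mo : Fin N → lorentzGroup × E4)
    (σ : Fin N → ℝ → ℝ) (dr : Fin N → ℝ → E4) (T : ℝ) (U : Opens E4) (Φ : U → 𝓢.carrier)
    (i : Fin N) (M a τ : ℝ) (Ψ : (boostedKerrBackground (mo i).1 (mo i).2 M a).domain → 𝓢.carrier) :
    Prop :=
  let B := boostedKerrBackground (mo i).1 (mo i).2 M a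
  let t := fun (x : E4) => poincareInv (mo i).1 (mo i).2 x 0
  let d := fun (x : E4) => E4.spatialNorm (poincareInv (mo i).1 (mo i).2 x)
  let W := {x : B.domain | τ < t x.1 ∧ d x.1 < σ i (t x.1) + |a| + 6}
  Kerr.IsSubextremal M a ∧
  ContMDiff 𝓘(ℝ, E4) (𝓡 4) ∞ Ψ ∧
  Topology.IsOpenEmbedding (W.restrict Ψ) ∧
  Ψ '' W ⊆ 𝓢.metric.causalFuture 𝓢.timeOrientation S ∧
  (∀ r : ℝ, Tendsto (fun τ' : ℝ ↦ 𝓢.truncDeviationCk B Ψ 2 r τ') atTop (𝓝 0)) ∧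
  Tendsto (fun τ' : ℝ ↦ 𝓢.truncDeviationCk B Ψ 2 (σ i τ' + 5) τ') atTop (𝓝 0) ∧
  (∀ x : B.domain, τ < t x.1 → σ i (t x.1) + 1 ≤ d x.1 → d x.1 < σ i (t x.1) + 4 →
    T + 1 < (x.1 + dr i (t x.1)) 0 → ∃ hx : x.1 + dr i (t x.1) ∈ (U : Set E4), Ψ x = Φ ⟨_, hx⟩)

/-! ## Registered stubs (the ONLY `sorry`s of this file) -/

/-- **Registered stub S1 — capture along EACH ray (localised sub-extremal Kerr stability, iterated over
scales; XL, the load-bearing stub).**  For every admissible datum `D`, MGHD `𝒟` and cone data, and every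
ray `i`: there are sub-extremal `(M,a)`, a cut-off rest time `τ` and a chart `Ψ` of the boosted Kerr
exterior `(Λᵢ,cᵢ,M,a)` with `RayCapture … i M a τ Ψ`.  Intended proof: at a late enough recurrence time of the
cone's BASIN clause (an `ε₀(Mᵢ,aᵢ)`-close glued chart on the truncated slab `rᵢ ≤ σᵢ(τ)+5`), with the
scale-invariantly small exterior input read off the cone's flatness clauses, a LOCALISED sub-extremal Kerr
stability theorem in the co-moving frame (printed only for whole-slice data with `r^{-1-ε}` tails, Hintz
arXiv:2606.28253 Thm 1.1 / 13.1; slowly rotating: Klainerman–Szeftel 2023) gives a development chart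
converging to a nearby sub-extremal Kerr, built in a gauge anchored to `Φ` beyond the annulus; iterate over
dyadic scales to reach the growing radius `σᵢ(τ')+5`.  Why it might fail: localisation (truncated-slab
closeness along a time sequence only, `o(1)` unweighted far input, boosted drifting frames) is not in print;
`ε₀ → 0` as `|a| → M`.  No `T ≤ τ`, no common time, no separation is asked here. -/
theorem stub_captureAlongEachRay :
    ∀ (X : Type) [TopologicalSpace X] [ChartedSpace E3 X] [IsManifold (𝓡 3) ∞ X] [T2Space X]
      [SecondCountableTopology X] [ConnectedSpace X] (D : InitialDataSet (𝓡 3) X),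
      D ∈ admissibleVacuumData X → ∀ 𝒟 : VacuumCauchyDevelopment D, 𝒟.IsMaximal →
      ∀ (N : ℕ) (mo : Fin N → lorentzGroup × E4) (σ : Fin N → ℝ → ℝ) (dr : Fin N → ℝ → E4) (T : ℝ)
        (U : Opens E4) (Φ : U → 𝒟.carrier),
        ConeData 𝒟.toSpacetime (range 𝒟.embed) N mo σ dr T U Φ →
        ∀ i : Fin N, ∃ (M a τ : ℝ)
          (Ψ : (boostedKerrBackground (mo i).1 (mo i).2 M a).domain → 𝒟.carrier),
          RayCapture 𝒟.toSpacetime (range 𝒟.embed) N mo σ dr T U Φ i M a τ Ψ := by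
  sorry

/-- **Registered stub S2 — captured rays SEPARATE (causal / flat bookkeeping; L).**  For every admissible
datum, MGHD and cone data, and EVERY family of captured charts `(Mᵢ, aᵢ, τᵢ, Ψᵢ)` with
`RayCapture … i (M i) (a i) (τ i) (Ψ i)` for all `i`: for every radius `r` there is `τ₁` such that the
truncated world-tubes `Ψᵢ '' {t*ᵢ > τ₁, rᵢ ≤ r}` are pairwise disjoint.  Intended proof: the cone's drifted
tubes `tubeᵢ(5)` are pairwise disjoint after time `T` and force pairwise distinct asymptotic velocities
(linear separation of the rays, `σᵢ` sublinear); the annulus agreement pins each captured chart to its own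
island in flat coordinates (near-isometric rigidity of `Φ⁻¹ ∘ Ψᵢ`, `C²`-closeness on the growing slabs), and
a flat-time / `t*ᵢ`-time monotonicity argument along causal curves excludes a common point of two late
near zones.  Why it might fail: as typed the antecedent admits ANY captured family — a non-localised
("wandering") captured chart is excluded only through the rigidity step, whose error budget `o(1)·σᵢ²` is
not controlled by the cone's rate-free flatness; repair (if a witness appears) by adding a flat-localisation
clause to `RayCapture`, which S1's construction supplies.  Vacuous for `N ≤ 1`. -/
theorem stub_capturedRaysSeparate :
    ∀ (X : Type) [TopologicalSpace X] [ChartedSpace E3 X] [IsManifold (𝓡 3) ∞ X] [T2Space X]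
      [SecondCountableTopology X] [ConnectedSpace X] (D : InitialDataSet (𝓡 3) X),
      D ∈ admissibleVacuumData X → ∀ 𝒟 : VacuumCauchyDevelopment D, 𝒟.IsMaximal →
      ∀ (N : ℕ) (mo : Fin N → lorentzGroup × E4) (σ : Fin N → ℝ → ℝ) (dr : Fin N → ℝ → E4) (T : ℝ)
        (U : Opens E4) (Φ : U → 𝒟.carrier),
        ConeData 𝒟.toSpacetime (range 𝒟.embed) N mo σ dr T U Φ →
        ∀ (M a τ : Fin N → ℝ)
          (Ψ : ∀ i, (boostedKerrBackground (mo i).1 (mo i).2 (M i) (a i)).domain → 𝒟.carrier),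
          (∀ i, RayCapture 𝒟.toSpacetime (range 𝒟.embed) N mo σ dr T U Φ i (M i) (a i) (τ i) (Ψ i)) →
          ∀ r : ℝ, ∃ τ₁ : ℝ, Pairwise (Function.onFun Disjoint fun i ↦
            Ψ i '' (boostedKerrBackground (mo i).1 (mo i).2 (M i) (a i)).truncLateRegion τ₁ r) := by
  sorry

/-! ## Name-keyed statements of the registered stubs

`Registered.stub_X : Prop` is the statement of `stub_X` under the stub's own short name, so that the
hypotheses of `KerrCaptureOnRays_of` read as the registered stubs BY NAME. -/
namespace Registered

/-- Statement of `stub_captureAlongEachRay` (S1). -/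
abbrev stub_captureAlongEachRay : Prop :=
  ∀ (X : Type) [TopologicalSpace X] [ChartedSpace E3 X] [IsManifold (𝓡 3) ∞ X] [T2Space X]
    [SecondCountableTopology X] [ConnectedSpace X] (D : InitialDataSet (𝓡 3) X),
    D ∈ admissibleVacuumData X → ∀ 𝒟 : VacuumCauchyDevelopment D, 𝒟.IsMaximal →
    ∀ (N : ℕ) (mo : Fin N → lorentzGroup × E4) (σ : Fin N → ℝ → ℝ) (dr : Fin N → ℝ → E4) (T : ℝ)
      (U : Opens E4) (Φ : U → 𝒟.carrier),
      ConeData 𝒟.toSpacetime (range 𝒟.embed) N mo σ dr T U Φ →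
      ∀ i : Fin N, ∃ (M a τ : ℝ)
        (Ψ : (boostedKerrBackground (mo i).1 (mo i).2 M a).domain → 𝒟.carrier),
        RayCapture 𝒟.toSpacetime (range 𝒟.embed) N mo σ dr T U Φ i M a τ Ψ

/-- Statement of `stub_capturedRaysSeparate` (S2). -/
abbrev stub_capturedRaysSeparate : Prop :=
  ∀ (X : Type) [TopologicalSpace X] [ChartedSpace E3 X] [IsManifold (𝓡 3) ∞ X] [T2Space X]
    [SecondCountableTopology X] [ConnectedSpace X] (D : InitialDataSet (𝓡 3) X),
    D ∈ admissibleVacuumData X → ∀ 𝒟 : VacuumCauchyDevelopment D, 𝒟.IsMaximal →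
    ∀ (N : ℕ) (mo : Fin N → lorentzGroup × E4) (σ : Fin N → ℝ → ℝ) (dr : Fin N → ℝ → E4) (T : ℝ)
      (U : Opens E4) (Φ : U → 𝒟.carrier),
      ConeData 𝒟.toSpacetime (range 𝒟.embed) N mo σ dr T U Φ →
      ∀ (M a τ : Fin N → ℝ)
        (Ψ : ∀ i, (boostedKerrBackground (mo i).1 (mo i).2 (M i) (a i)).domain → 𝒟.carrier),
        (∀ i, RayCapture 𝒟.toSpacetime (range 𝒟.embed) N mo σ dr T U Φ i (M i) (a i) (τ i) (Ψ i)) →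
        ∀ r : ℝ, ∃ τ₁ : ℝ, Pairwise (Function.onFun Disjoint fun i ↦
          Ψ i '' (boostedKerrBackground (mo i).1 (mo i).2 (M i) (a i)).truncLateRegion τ₁ r)

end Registered

/-- Consistency check: the registered stubs prove their name-keyed statements. -/
example : Registered.stub_captureAlongEachRay ∧ Registered.stub_capturedRaysSeparate :=
  ⟨stub_captureAlongEachRay, stub_capturedRaysSeparate⟩

/-! ## Bookkeeping lemmas of the composition (proved) -/

/-- Restricting an open embedding `s.restrict f` to a smaller OPEN set `u ⊆ s` (with `s` open) is again an
open embedding. -/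
theorem isOpenEmbedding_restrict_of_subset {α β : Type*} [TopologicalSpace α] [TopologicalSpace β]
    {f : α → β} {s u : Set α} (hf : Topology.IsOpenEmbedding (s.restrict f)) (hs : IsOpen s)
    (hu : IsOpen u) (hus : u ⊆ s) : Topology.IsOpenEmbedding (u.restrict f) := by
  have hj : Topology.IsOpenEmbedding (Set.inclusion hus) :=
    Topology.IsOpenEmbedding.of_comp (Set.inclusion hus) hs.isOpenEmbedding_subtypeVal
      hu.isOpenEmbedding_subtypeVal
  exact hf.comp hj

/-- The near regions are open (continuity of the inverse Poincaré map, of the spatial norm, and of `σᵢ`). -/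
theorem isOpen_nearRegion {N : ℕ} (mo : Fin N → lorentzGroup × E4) (σ : Fin N → ℝ → ℝ) (i : Fin N)
    (hσ : Continuous (σ i)) (M a τ : ℝ) : IsOpen (nearRegion mo σ i M a τ) := by
  have ht : Continuous fun y : E4 ↦ poincareInv (mo i).1 (mo i).2 y 0 :=
    (PiLp.continuous_apply 2 _ 0).comp (continuous_poincareInv _ _)
  have hd : Continuous fun y : E4 ↦ E4.spatialNorm (poincareInv (mo i).1 (mo i).2 y) :=
    continuous_norm.comp (E4.spatial.continuous.comp (continuous_poincareInv _ _))
  have h : IsOpen {y : E4 | τ < poincareInv (mo i).1 (mo i).2 y 0 ∧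
      E4.spatialNorm (poincareInv (mo i).1 (mo i).2 y) <
        σ i (poincareInv (mo i).1 (mo i).2 y 0) + |a| + 6} :=
    (isOpen_lt continuous_const ht).inter
      (isOpen_lt hd (((hσ.comp ht).add continuous_const).add continuous_const))
  exact h.preimage continuous_subtype_val

/-- The near regions shrink as the cut-off time grows. -/
theorem nearRegion_anti {N : ℕ} (mo : Fin N → lorentzGroup × E4) (σ : Fin N → ℝ → ℝ) (i : Fin N)
    (M a : ℝ) {τ τ' : ℝ} (h : τ ≤ τ') : nearRegion mo σ i M a τ' ⊆ nearRegion mo σ i M a τ :=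
  fun _ hx ↦ ⟨h.trans_lt hx.1, hx.2⟩

/-- **From captured rays to hole data** (the bookkeeping half of the composition, proved): per-ray captured
charts with cut-off times `τᵢ`, a common time `τ₀ ≥ T` with `τᵢ ≤ τ₀`, and pairwise separation give the
crux's `HoleData` at `τ₀` — the open-embedding and `J⁺` clauses restrict to the smaller open near regions
`Wᵢ(τ₀) ⊆ Wᵢ(τᵢ)`, the annulus clause weakens, the convergence clauses are time-free. -/
theorem holeData_of_rayCapture (𝓢 : Spacetime.{0} 4) (S : Set 𝓢.carrier) (N : ℕ)
    (mo : Fin N → lorentzGroup × E4) (σ : Fin N → ℝ → ℝ) (dr : Fin N → ℝ → E4) (T : ℝ) (U : Opens E4)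
    (Φ : U → 𝓢.carrier) (hσ : ∀ i, Continuous (σ i)) (M a τ : Fin N → ℝ)
    (Ψ : ∀ i, (boostedKerrBackground (mo i).1 (mo i).2 (M i) (a i)).domain → 𝓢.carrier)
    (hΨ : ∀ i, RayCapture 𝓢 S N mo σ dr T U Φ i (M i) (a i) (τ i) (Ψ i))
    {τ₀ : ℝ} (hT : T ≤ τ₀) (hτ : ∀ i, τ i ≤ τ₀)
    (hsep : ∀ r : ℝ, ∃ τ₁ : ℝ, Pairwise (Function.onFun Disjoint fun i ↦
      Ψ i '' (boostedKerrBackground (mo i).1 (mo i).2 (M i) (a i)).truncLateRegion τ₁ r)) :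
    HoleData 𝓢 S N mo σ dr T U Φ M a τ₀ Ψ := by
  dsimp only [RayCapture] at hΨ
  dsimp only [HoleData]
  refine ⟨fun i ↦ (hΨ i).1, hT, fun i ↦ ⟨(hΨ i).2.1, ?_, ?_⟩, fun i r ↦ (hΨ i).2.2.2.2.1 r,
    fun i ↦ (hΨ i).2.2.2.2.2.1, fun i x ht hd₁ hd₂ hT₁ ↦ (hΨ i).2.2.2.2.2.2 x ((hτ i).trans_lt ht) hd₁ hd₂ hT₁,
    hsep⟩
  · -- the open embedding restricts to the later (smaller, open) near region
    exact isOpenEmbedding_restrict_of_subset (hΨ i).2.2.1 (isOpen_nearRegion mo σ i (hσ i) (M i) (a i) (τ i))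
      (isOpen_nearRegion mo σ i (hσ i) (M i) (a i) τ₀) (nearRegion_anti mo σ i (M i) (a i) (hτ i))
  · -- the image of the smaller near region still lies in `J⁺(S)`
    exact (Set.image_mono (nearRegion_anti mo σ i (M i) (a i) (hτ i))).trans (hΨ i).2.2.2.1

/-! ## The composition (kernel-checked, no sorry of its own) -/

/-- **Skeleton theorem.**  S1 → S2 → the crux `Theses.TangentConeAtIPlus.KerrCaptureOnRays`, BY NAME:
unfold the crux (`kerrCaptureOnRays_iff`, definitional); capture every ray separately (S1) and CHOOSE the
family over the finitely many rays; take the common late time `τ₀ := max T b` with `b` an upper bound of the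
finitely many cut-off times; separation of this family (S2); assemble the hole data
(`holeData_of_rayCapture`, using continuity of `σᵢ` from the cone data for the openness of the near
regions). -/
theorem KerrCaptureOnRays_of (h₁ : Registered.stub_captureAlongEachRay)
    (h₂ : Registered.stub_capturedRaysSeparate) : Theses.TangentConeAtIPlus.KerrCaptureOnRays := by
  rw [kerrCaptureOnRays_iff]
  intro X _ _ _ _ _ _ D hD 𝒟 h𝒟 N mo σ dr T U Φ hcone
  -- S1: a captured chart along each ray; choice over `Fin N`
  choose M a τ Ψ hΨ using h₁ X D hD 𝒟 h𝒟 N mo σ dr T U Φ hcone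
  -- S2: the truncated world-tubes of this family separate
  have hsep := h₂ X D hD 𝒟 h𝒟 N mo σ dr T U Φ hcone M a τ Ψ hΨ
  -- a common late time dominating `T` and every per-ray cut-off
  obtain ⟨b, hb⟩ := (Set.finite_range τ).bddAbove
  have hτle : ∀ i, τ i ≤ max T b := fun i ↦ (hb (Set.mem_range_self i)).trans (le_max_right T b)
  -- continuity of the near-zone radii is a clause of the cone data
  have hc := hcone
  dsimp only [ConeData] at hc
  have hσ : ∀ i, Continuous (σ i) := fun i ↦ (hc.1 i).2.1
  exact ⟨M, a, max T b, Ψ, holeData_of_rayCapture 𝒟.toSpacetime (range 𝒟.embed) N mo σ dr T U Φ hσ M a τ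
    Ψ hΨ (le_max_left T b) hτle hsep⟩

/-- Wiring check: the registered stubs feed `KerrCaptureOnRays_of` as stated (an `example`, so that
`KerrCaptureOnRays_of` stays the unique theorem of this file concluding the crux). -/
example : Theses.TangentConeAtIPlus.KerrCaptureOnRays :=
  KerrCaptureOnRays_of stub_captureAlongEachRay stub_capturedRaysSeparate

end Summit.FinalStateConjecture.FinalStateConjecture.Cruxes.KerrCaptureOnRays.Birth

end
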